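/-
  HodgeLocusCensusInclusionRankShadows.lean — pub-hlocus ENGINE B (ivhs-2, gen 55), PROBE 15c (successor material, R-L572 (b)/(d); probe-only, NOT filed).
  certified instances and evidence bearing on the general Hodge conjecture; no claim.
  KERNEL RANK THEOREMS (evidence class; linear algebra of inclusion matrices; nothing about HC). SHADOWS, SUPPORTS, VANISHING BELOW 2j POINTS, THE SPACES
  S_j(V). For x on i-sets avoiding a: ψ_{k+1←i+1} (ins_a x) = ins_a (ψ_{k←i} x) + ψ_{k+1←i} x, ψ_{0←i+1} (ins_a x) = ψ_{0←i} x (`incl_ins_succ/zero`), so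
  Δ_{a,q} := ins_a − ins_q RAISES the kernel filtration ⋂_{k<j} ker ψ_{k←·} by one and carries ψ_{j←i} along (`incl_delta_eq_zero`, `incl_delta_succ`);
  del_a LOWERS it by one (`incl_del_eq_zero`); ins_a del_a z = z·[a ∈ B] (`ins_del_apply`); support bookkeeping (`supp_del`, `supp_ins`, `supp_sub_ins_del`).
  VANISHING (`eq_zero_of_card_lt`; Wilson 1990 (3.2)): a vector on the j-subsets of V whose k-shadows (k < j) all vanish is 0 once #V < 2j
  (z B₀ = Σ_B z B · Σ_{S ⊆ B ∖ B₀} (−1)^{#S}: the S-shadow vanishes unless #S = j, and then S ⊆ V, S ∩ B₀ = ∅ needs 2j points). THE SPACES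
  S_j(V) := (⨅_{k<j} ker ψ_{k←j}) ⊓ (⨅_{B ⊄ V} ker eval_B), WRITTEN OUT at every use (no definition introduced; def-free re-cut, LEAD gen 55 PS 8 (d) β):
  `mem_shadowKer` (membership iff), `shadowKer_mono`, `shadowKer_le_ker`, `iSup_shadowKer_le_ker`; del_a : S_{j+1}(V) → S_j(V ∖ a) (`del_mem`);
  Δ_{a,q} : S_j(V'') → S_{j+1}(V'' ∪ {a,q}) for a, q ∉ V'' (`delta_mem`); an induction principle for ⨆_{q ∈ s} (`biSup_induction`).
  19 theorems, 0 defs; imports PROBE 15b `…Theorems.HodgeLocusCensusInclusionRankPointOps` by name; no sorries, axioms, instances or notation.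
-/
import Summits.HodgeConjecture.HodgeConjecture.Theorems.HodgeLocusCensusInclusionRankPointOps

set_option linter.dupNamespace false
set_option autoImplicit false

namespace Summit.HodgeConjecture.HodgeConjecture.HodgeLocus.Census.InclusionRankShadows

open Module
open Summit.HodgeConjecture.HodgeConjecture.HodgeLocus.Census.InclusionRankPointOps

variable (K : Type*) [Field K] {α : Type*} [Fintype α] [DecidableEq α]
/-! ## §3 consequences: commutation with `ψ`, supports, kernels -/
/-- the action of a `0/1` matrix `[P c b]`: `(M x) c = Σ_{b, P c b} x b`. -/
theorem boole_mulVecLin_apply {m n : Type*} [Fintype m] [Fintype n] (P : m → n → Prop)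
    [∀ c b, Decidable (P c b)] (x : n → K) (c : m) :
    Matrix.mulVecLin (Matrix.of fun (c : m) (b : n) => if P c b then (1 : K) else 0) x c =
      ∑ b, if P c b then x b else 0 := by
  rw [Matrix.mulVecLin_apply, Matrix.mulVec, dotProduct]
  refine Finset.sum_congr rfl (fun b _ => ?_)
  rw [Matrix.of_apply, boole_mul]

/-- `ψ_{k←i+1}(ins_a x)(C) = Σ_{B' ⊇ C ∖ a} x(B')` for `x` avoiding `a`. -/
theorem incl_ins_apply (a : α) (k i : ℕ) (x : {S : Finset α // S.card = i} → K)
    (hx : ∀ T : {S : Finset α // S.card = i}, a ∈ T.1 → x T = 0) (C : {S : Finset α // S.card = k}) :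
    Matrix.mulVecLin (Matrix.of fun (S : {S : Finset α // S.card = k}) (T : {S : Finset α // S.card = i + 1}) =>
        if S.1 ⊆ T.1 then (1 : K) else 0)
      (Matrix.mulVecLin (Matrix.of fun (B : {S : Finset α // S.card = i + 1})
        (B' : {S : Finset α // S.card = i}) => if B.1 = insert a B'.1 then (1 : K) else 0) x) C =
      ∑ B' : {S : Finset α // S.card = i}, if C.1.erase a ⊆ B'.1 then x B' else 0 := by
  rw [← LinearMap.comp_apply, ← Matrix.mulVecLin_mul, incl_mul_ins K a k i, boole_mulVecLin_apply]
  refine Finset.sum_congr rfl (fun B' _ => ?_)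
  by_cases ha : a ∈ B'.1
  · rw [if_neg (fun h => h.1 ha), hx B' ha, ite_self]
  · simp only [ha, not_false_eq_true, true_and]

/-- GENERAL COMMUTATION (positive levels): for `x` avoiding `a`,
`ψ_{k+1←i+1}(ins_a x) = ins_a (ψ_{k←i} x) + ψ_{k+1←i} x`. -/
theorem incl_ins_succ (a : α) (k i : ℕ) (x : {S : Finset α // S.card = i} → K)
    (hx : ∀ T : {S : Finset α // S.card = i}, a ∈ T.1 → x T = 0) :
    Matrix.mulVecLin (Matrix.of fun (S : {S : Finset α // S.card = k + 1})
        (T : {S : Finset α // S.card = i + 1}) => if S.1 ⊆ T.1 then (1 : K) else 0)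
      (Matrix.mulVecLin (Matrix.of fun (B : {S : Finset α // S.card = i + 1})
        (B' : {S : Finset α // S.card = i}) => if B.1 = insert a B'.1 then (1 : K) else 0) x) =
      Matrix.mulVecLin (Matrix.of fun (B : {S : Finset α // S.card = k + 1})
        (B' : {S : Finset α // S.card = k}) => if B.1 = insert a B'.1 then (1 : K) else 0)
      (Matrix.mulVecLin (Matrix.of fun (S : {S : Finset α // S.card = k})
        (T : {S : Finset α // S.card = i}) => if S.1 ⊆ T.1 then (1 : K) else 0) x) +
      Matrix.mulVecLin (Matrix.of fun (S : {S : Finset α // S.card = k + 1})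
        (T : {S : Finset α // S.card = i}) => if S.1 ⊆ T.1 then (1 : K) else 0) x := by
  funext C
  rw [incl_ins_apply K a (k + 1) i x hx C, Pi.add_apply, ins_mulVecLin_apply, incl_mulVecLin_apply]
  by_cases ha : a ∈ C.1
  · have h0 : (∑ T : {S : Finset α // S.card = i}, if C.1 ⊆ T.1 then x T else 0) = 0 :=
      Finset.sum_eq_zero (fun T _ => by
        by_cases hCT : C.1 ⊆ T.1
        · rw [if_pos hCT, hx T (hCT ha)]
        · rw [if_neg hCT])
    rw [dif_pos ha, incl_mulVecLin_apply, h0, add_zero]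
  · rw [dif_neg ha, zero_add, Finset.erase_eq_of_notMem ha]

/-- GENERAL COMMUTATION (level `0`): for `x` avoiding `a`, `ψ_{0←i+1}(ins_a x) = ψ_{0←i} x`. -/
theorem incl_ins_zero (a : α) (i : ℕ) (x : {S : Finset α // S.card = i} → K)
    (hx : ∀ T : {S : Finset α // S.card = i}, a ∈ T.1 → x T = 0) :
    Matrix.mulVecLin (Matrix.of fun (S : {S : Finset α // S.card = 0})
        (T : {S : Finset α // S.card = i + 1}) => if S.1 ⊆ T.1 then (1 : K) else 0)
      (Matrix.mulVecLin (Matrix.of fun (B : {S : Finset α // S.card = i + 1})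
        (B' : {S : Finset α // S.card = i}) => if B.1 = insert a B'.1 then (1 : K) else 0) x) =
      Matrix.mulVecLin (Matrix.of fun (S : {S : Finset α // S.card = 0})
        (T : {S : Finset α // S.card = i}) => if S.1 ⊆ T.1 then (1 : K) else 0) x := by
  funext C
  have hC : C.1 = ∅ := Finset.card_eq_zero.mp C.2
  rw [incl_ins_apply K a 0 i x hx C, incl_mulVecLin_apply, hC, Finset.erase_empty]

/-- THE DIFFERENCE-INSERTION `Δ_{a,q} := ins_a − ins_q` RAISES THE KERNEL FILTRATION BY ONE:
if `x` (level `i`) avoids `a` and `q` and `ψ_{k←i} x = 0` for all `k < j`, then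
`ψ_{k←i+1}(ins_a x − ins_q x) = 0` for all `k < j + 1`. -/
theorem incl_delta_eq_zero (a q : α) (i j : ℕ) (x : {S : Finset α // S.card = i} → K)
    (ha : ∀ T : {S : Finset α // S.card = i}, a ∈ T.1 → x T = 0)
    (hq : ∀ T : {S : Finset α // S.card = i}, q ∈ T.1 → x T = 0)
    (hx : ∀ k : ℕ, k < j → Matrix.mulVecLin (Matrix.of fun (S : {S : Finset α // S.card = k})
        (T : {S : Finset α // S.card = i}) => if S.1 ⊆ T.1 then (1 : K) else 0) x = 0)
    (k : ℕ) (hk : k < j + 1) :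
    Matrix.mulVecLin (Matrix.of fun (S : {S : Finset α // S.card = k})
        (T : {S : Finset α // S.card = i + 1}) => if S.1 ⊆ T.1 then (1 : K) else 0)
      (Matrix.mulVecLin (Matrix.of fun (B : {S : Finset α // S.card = i + 1})
          (B' : {S : Finset α // S.card = i}) => if B.1 = insert a B'.1 then (1 : K) else 0) x -
        Matrix.mulVecLin (Matrix.of fun (B : {S : Finset α // S.card = i + 1})
          (B' : {S : Finset α // S.card = i}) => if B.1 = insert q B'.1 then (1 : K) else 0) x) = 0 := by
  rw [map_sub]
  rcases Nat.eq_zero_or_pos k with rfl | hpos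
  · rw [incl_ins_zero K a i x ha, incl_ins_zero K q i x hq, sub_self]
  · obtain ⟨k', rfl⟩ : ∃ k', k = k' + 1 := ⟨k - 1, by omega⟩
    rw [incl_ins_succ K a k' i x ha, incl_ins_succ K q k' i x hq, hx k' (by omega), map_zero, map_zero,
      sub_self]

/-- … AND CARRIES THE `j`-TH IMAGE ALONG: `ψ_{j+1←i+1}(ins_a x − ins_q x) = ins_a(ψ_{j←i} x) − ins_q(ψ_{j←i} x)`. -/
theorem incl_delta_succ (a q : α) (i j : ℕ) (x : {S : Finset α // S.card = i} → K)
    (ha : ∀ T : {S : Finset α // S.card = i}, a ∈ T.1 → x T = 0)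
    (hq : ∀ T : {S : Finset α // S.card = i}, q ∈ T.1 → x T = 0) :
    Matrix.mulVecLin (Matrix.of fun (S : {S : Finset α // S.card = j + 1})
        (T : {S : Finset α // S.card = i + 1}) => if S.1 ⊆ T.1 then (1 : K) else 0)
      (Matrix.mulVecLin (Matrix.of fun (B : {S : Finset α // S.card = i + 1})
          (B' : {S : Finset α // S.card = i}) => if B.1 = insert a B'.1 then (1 : K) else 0) x -
        Matrix.mulVecLin (Matrix.of fun (B : {S : Finset α // S.card = i + 1})
          (B' : {S : Finset α // S.card = i}) => if B.1 = insert q B'.1 then (1 : K) else 0) x) =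
      Matrix.mulVecLin (Matrix.of fun (B : {S : Finset α // S.card = j + 1})
          (B' : {S : Finset α // S.card = j}) => if B.1 = insert a B'.1 then (1 : K) else 0)
        (Matrix.mulVecLin (Matrix.of fun (S : {S : Finset α // S.card = j})
          (T : {S : Finset α // S.card = i}) => if S.1 ⊆ T.1 then (1 : K) else 0) x) -
      Matrix.mulVecLin (Matrix.of fun (B : {S : Finset α // S.card = j + 1})
          (B' : {S : Finset α // S.card = j}) => if B.1 = insert q B'.1 then (1 : K) else 0)
        (Matrix.mulVecLin (Matrix.of fun (S : {S : Finset α // S.card = j})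
          (T : {S : Finset α // S.card = i}) => if S.1 ⊆ T.1 then (1 : K) else 0) x) := by
  rw [map_sub, incl_ins_succ K a j i x ha, incl_ins_succ K q j i x hq]
  abel

/-- `del_a` LOWERS THE KERNEL FILTRATION BY ONE: `ψ_{k←j} (del_a z) = del_a (ψ_{k+1←j+1} z)`, hence
`ψ_{k←j}(del_a z) = 0` whenever `ψ_{k+1←j+1} z = 0`. -/
theorem incl_del_eq_zero (a : α) (k j : ℕ) (z : {S : Finset α // S.card = j + 1} → K)
    (hz : Matrix.mulVecLin (Matrix.of fun (S : {S : Finset α // S.card = k + 1})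
        (T : {S : Finset α // S.card = j + 1}) => if S.1 ⊆ T.1 then (1 : K) else 0) z = 0) :
    Matrix.mulVecLin (Matrix.of fun (S : {S : Finset α // S.card = k})
        (T : {S : Finset α // S.card = j}) => if S.1 ⊆ T.1 then (1 : K) else 0)
      (Matrix.mulVecLin (Matrix.of fun (B' : {S : Finset α // S.card = j})
        (B : {S : Finset α // S.card = j + 1}) => if B.1 = insert a B'.1 then (1 : K) else 0) z) = 0 := by
  rw [← LinearMap.comp_apply, ← Matrix.mulVecLin_mul, incl_mul_del K a k j, Matrix.mulVecLin_mul,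
    LinearMap.comp_apply, hz, map_zero]

/-- `ins_a (del_a z)` is `z` restricted to the sets containing `a`. -/
theorem ins_del_apply (a : α) (j : ℕ) (z : {S : Finset α // S.card = j + 1} → K)
    (B : {S : Finset α // S.card = j + 1}) :
    Matrix.mulVecLin (Matrix.of fun (B : {S : Finset α // S.card = j + 1})
        (B' : {S : Finset α // S.card = j}) => if B.1 = insert a B'.1 then (1 : K) else 0)
      (Matrix.mulVecLin (Matrix.of fun (B' : {S : Finset α // S.card = j})
        (B : {S : Finset α // S.card = j + 1}) => if B.1 = insert a B'.1 then (1 : K) else 0) z) B =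
      if a ∈ B.1 then z B else 0 := by
  rw [← LinearMap.comp_apply, ← Matrix.mulVecLin_mul, ins_mul_del K a j,
    boole_mulVecLin_apply K (fun (B B₂ : {S : Finset α // S.card = j + 1}) => B = B₂ ∧ a ∈ B.1) z B]
  by_cases ha : a ∈ B.1
  · rw [if_pos ha, Finset.sum_eq_single B]
    · rw [if_pos ⟨rfl, ha⟩]
    · intro B₂ _ hB₂
      rw [if_neg (fun h => hB₂ h.1.symm)]
    · intro hB
      exact absurd (Finset.mem_univ _) hB
  · rw [if_neg ha]
    exact Finset.sum_eq_zero (fun B₂ _ => if_neg (fun h => ha h.2))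

/-! ### supports -/
/-- for `z` supported on the `(j+1)`-subsets of `V`, `Del_a z` is supported on the `j`-subsets of `V.erase a`. -/
theorem supp_del (a : α) (j : ℕ) (V : Finset α) (z : {S : Finset α // S.card = j + 1} → K)
    (hz : ∀ B : {S : Finset α // S.card = j + 1}, ¬ B.1 ⊆ V → z B = 0)
    (B' : {S : Finset α // S.card = j}) (hB' : ¬ B'.1 ⊆ V.erase a) :
    Matrix.mulVecLin (Matrix.of fun (B' : {S : Finset α // S.card = j})
      (B : {S : Finset α // S.card = j + 1}) => if B.1 = insert a B'.1 then (1 : K) else 0) z B' = 0 := by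
  rw [del_mulVecLin_apply]
  split_ifs with ha
  · rfl
  · apply hz
    intro hsub
    apply hB'
    intro y hy
    exact Finset.mem_erase.mpr ⟨fun h => ha (h ▸ hy), hsub (Finset.mem_insert_of_mem hy)⟩
/-- `Ins_q` maps a vector supported on the `j`-subsets of `V` to one supported on the `(j+1)`-subsets of `insert q V`. -/
theorem supp_ins (q : α) (j : ℕ) (V : Finset α) (w : {S : Finset α // S.card = j} → K)
    (hw : ∀ B' : {S : Finset α // S.card = j}, ¬ B'.1 ⊆ V → w B' = 0)
    (B : {S : Finset α // S.card = j + 1}) (hB : ¬ B.1 ⊆ insert q V) :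
    Matrix.mulVecLin (Matrix.of fun (B : {S : Finset α // S.card = j + 1})
      (B' : {S : Finset α // S.card = j}) => if B.1 = insert q B'.1 then (1 : K) else 0) w B = 0 := by
  rw [ins_mulVecLin_apply]
  split_ifs with hq
  · apply hw
    intro hsub
    exact hB (Finset.subset_insert_iff.mpr hsub)
  · rfl
/-- for `z` supported on the `(j+1)`-subsets of `V`, `z − Ins_a (Del_a z)` is supported on the `(j+1)`-subsets of `V.erase a`. -/
theorem supp_sub_ins_del (a : α) (j : ℕ) (V : Finset α) (z : {S : Finset α // S.card = j + 1} → K)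
    (hz : ∀ B : {S : Finset α // S.card = j + 1}, ¬ B.1 ⊆ V → z B = 0)
    (B : {S : Finset α // S.card = j + 1}) (hB : ¬ B.1 ⊆ V.erase a) :
    (z - Matrix.mulVecLin (Matrix.of fun (B : {S : Finset α // S.card = j + 1})
        (B' : {S : Finset α // S.card = j}) => if B.1 = insert a B'.1 then (1 : K) else 0)
      (Matrix.mulVecLin (Matrix.of fun (B' : {S : Finset α // S.card = j})
        (B : {S : Finset α // S.card = j + 1}) => if B.1 = insert a B'.1 then (1 : K) else 0) z)) B = 0 := by
  rw [Pi.sub_apply, ins_del_apply]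
  by_cases ha : a ∈ B.1
  · rw [if_pos ha, sub_self]
  · rw [if_neg ha, sub_zero]
    apply hz
    intro hsub
    exact hB (fun y hy => Finset.mem_erase.mpr ⟨fun h => ha (h ▸ hy), hsub hy⟩)

/-! ### the vanishing below `2j` points (Wilson's identity (3.2)) -/

/-- **VANISHING**: a vector on the `j`-subsets of `V` all of whose `k`-shadows (`k < j`) vanish is zero
as soon as `#V < 2j`. -/
theorem eq_zero_of_card_lt (j : ℕ) (V : Finset α) (hV : V.card < 2 * j)
    (z : {S : Finset α // S.card = j} → K)
    (hsupp : ∀ B : {S : Finset α // S.card = j}, ¬ B.1 ⊆ V → z B = 0)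
    (hz : ∀ k : ℕ, k < j → Matrix.mulVecLin (Matrix.of fun (S : {S : Finset α // S.card = k})
        (T : {S : Finset α // S.card = j}) => if S.1 ⊆ T.1 then (1 : K) else 0) z = 0) :
    z = 0 := by
  -- the `S`-shadow `ζ(S) := Σ_{B ⊇ S} z B` vanishes unless `#S = j`, where it is `z S`
  have shadow : ∀ S : Finset α, S.card ≠ j →
      (∑ B : {S : Finset α // S.card = j}, if S ⊆ B.1 then z B else 0) = 0 := by
    intro S hS
    rcases lt_or_gt_of_ne hS with hlt | hgt
    · have h := congrFun (hz S.card hlt) ⟨S, rfl⟩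
      rwa [incl_mulVecLin_apply, Pi.zero_apply] at h
    · refine Finset.sum_eq_zero (fun B _ => ?_)
      rw [if_neg]
      intro hSB
      have := Finset.card_le_card hSB
      rw [B.2] at this
      omega
  have shadow_eq : ∀ S : {S : Finset α // S.card = j},
      (∑ B : {S : Finset α // S.card = j}, if S.1 ⊆ B.1 then z B else 0) = z S := by
    intro S
    rw [Finset.sum_eq_single S]
    · rw [if_pos (subset_refl _)]
    · intro B _ hB
      rw [if_neg]
      intro hSB
      exact hB (Subtype.ext (Finset.eq_of_subset_of_card_le hSB (by rw [S.2, B.2]))).symm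
    · intro hS
      exact absurd (Finset.mem_univ _) hS
  funext B₀
  rw [Pi.zero_apply]
  by_cases hB₀ : B₀.1 ⊆ V
  swap
  · exact hsupp B₀ hB₀
  -- `z B₀ = Σ_B z B · Σ_{S ⊆ B ∖ B₀} (−1)^{#S}`
  have key : ∀ B : {S : Finset α // S.card = j},
      (∑ S ∈ (B.1 \ B₀.1).powerset, (-1 : K) ^ S.card) = if B = B₀ then 1 else 0 := by
    intro B
    have h := congrArg (Int.cast : ℤ → K) (Finset.sum_powerset_neg_one_pow_card (x := B.1 \ B₀.1))
    push_cast at h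
    rw [h]
    by_cases hB : B = B₀
    · rw [if_pos hB, if_pos (by rw [hB, Finset.sdiff_self])]
    · rw [if_neg hB, if_neg]
      intro hsub
      rw [Finset.sdiff_eq_empty_iff_subset] at hsub
      exact hB (Subtype.ext (Finset.eq_of_subset_of_card_le hsub (by rw [B.2, B₀.2])))
  have step1 : z B₀ = ∑ B : {S : Finset α // S.card = j}, z B * ∑ S ∈ (B.1 \ B₀.1).powerset, (-1 : K) ^ S.card := by
    simp_rw [key, mul_ite, mul_one, mul_zero]
    rw [Finset.sum_ite_eq' Finset.univ B₀, if_pos (Finset.mem_univ _)]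
  -- rewrite the inner sums over ALL finsets `S` and swap
  have step2 : ∀ B : {S : Finset α // S.card = j},
      (z B * ∑ S ∈ (B.1 \ B₀.1).powerset, (-1 : K) ^ S.card) =
      ∑ S : Finset α, if Disjoint S B₀.1 then (-1 : K) ^ S.card * (if S ⊆ B.1 then z B else 0) else 0 := by
    intro B
    rw [Finset.mul_sum, ← Finset.sum_filter_add_sum_filter_not Finset.univ (fun S => S ⊆ B.1 \ B₀.1)]
    rw [Finset.sum_eq_zero (s := Finset.univ.filter (fun S => ¬ S ⊆ B.1 \ B₀.1)) (fun S hS => ?_), add_zero]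
    · have hset : Finset.univ.filter (fun S : Finset α => S ⊆ B.1 \ B₀.1) = (B.1 \ B₀.1).powerset := by
        ext S
        rw [Finset.mem_filter, Finset.mem_powerset]
        simp only [Finset.mem_univ, true_and]
      rw [hset]
      refine Finset.sum_congr rfl (fun S hS => ?_)
      rw [Finset.mem_powerset, Finset.subset_sdiff] at hS
      rw [if_pos hS.2, if_pos hS.1, mul_comm]
    · rw [Finset.mem_filter, Finset.subset_sdiff, not_and_or] at hS
      rcases hS.2 with h | h
      · rw [if_neg h, mul_zero, ite_self]
      · rw [if_neg h]
  rw [step1, Finset.sum_congr rfl (fun B _ => step2 B), Finset.sum_comm]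
  refine Finset.sum_eq_zero (fun S _ => ?_)
  by_cases hdis : Disjoint S B₀.1
  swap
  · exact Finset.sum_eq_zero (fun B _ => if_neg hdis)
  simp_rw [if_pos hdis]
  rw [← Finset.mul_sum]
  by_cases hS : S.card = j
  · rw [shadow_eq ⟨S, hS⟩]
    by_cases hSV : S ⊆ V
    · exfalso
      have hcard := Finset.card_le_card (Finset.union_subset hSV hB₀)
      rw [Finset.card_union_of_disjoint hdis, hS, B₀.2] at hcard
      omega
    · rw [hsupp ⟨S, hS⟩ hSV, mul_zero]
  · rw [shadow S hS, mul_zero]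

/-! ## §4 the spaces `S_j(V)` -/
/-- membership in `S_j(V)` (written out as an inf of kernels): `z ∈ S_j(V)` iff `W_{k,j} z = 0` for every `k < j` and `z B = 0` for every `j`-set `B ⊄ V`. -/
theorem mem_shadowKer (j : ℕ) (V : Finset α) (z : {S : Finset α // S.card = j} → K) :
    z ∈ ((⨅ (k : ℕ) (_ : k < j),
          LinearMap.ker (Matrix.mulVecLin (Matrix.of fun (S : {S : Finset α // S.card = k}) (T : {S : Finset α // S.card = j}) =>
        if S.1 ⊆ T.1 then (1 : K) else 0))) ⊓
        (⨅ (B : {S : Finset α // S.card = j}) (_ : ¬ B.1 ⊆ V),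
          LinearMap.ker (LinearMap.proj (R := K) (φ := fun _ : {S : Finset α // S.card = j} => K) B)))
              ↔ (∀ k : ℕ, k < j → Matrix.mulVecLin (Matrix.of fun (S : {S : Finset α // S.card = k}) (T : {S : Finset α // S.card = j}) =>
        if S.1 ⊆ T.1 then (1 : K) else 0) z = 0) ∧
      ∀ B : {S : Finset α // S.card = j}, ¬ B.1 ⊆ V → z B = 0 := by
  simp only [Submodule.mem_inf, Submodule.mem_iInf, LinearMap.mem_ker, LinearMap.proj_apply]
/-- `S_j(V)` (written out) is monotone in `V`. -/
theorem shadowKer_mono (j : ℕ) {V V' : Finset α} (h : V ⊆ V') : ((⨅ (k : ℕ) (_ : k < j),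
          LinearMap.ker (Matrix.mulVecLin (Matrix.of fun (S : {S : Finset α // S.card = k}) (T : {S : Finset α // S.card = j}) =>
        if S.1 ⊆ T.1 then (1 : K) else 0))) ⊓
        (⨅ (B : {S : Finset α // S.card = j}) (_ : ¬ B.1 ⊆ V),
          LinearMap.ker (LinearMap.proj (R := K) (φ := fun _ : {S : Finset α // S.card = j} => K) B))) ≤ ((⨅ (k : ℕ) (_ : k < j),
          LinearMap.ker (Matrix.mulVecLin (Matrix.of fun (S : {S : Finset α // S.card = k}) (T : {S : Finset α // S.card = j}) =>
        if S.1 ⊆ T.1 then (1 : K) else 0))) ⊓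
        (⨅ (B : {S : Finset α // S.card = j}) (_ : ¬ B.1 ⊆ V'),
          LinearMap.ker (LinearMap.proj (R := K) (φ := fun _ : {S : Finset α // S.card = j} => K) B))) := by
  intro z hz
  rw [mem_shadowKer] at hz ⊢
  exact ⟨hz.1, fun B hB => hz.2 B (fun hBV => hB (hBV.trans h))⟩
/-- `S_j(V) ≤ ker W_{k,j}` for `k < j`. -/
theorem shadowKer_le_ker (j : ℕ) (V : Finset α) (k : ℕ) (hk : k < j) :
    ((⨅ (k : ℕ) (_ : k < j),
          LinearMap.ker (Matrix.mulVecLin (Matrix.of fun (S : {S : Finset α // S.card = k}) (T : {S : Finset α // S.card = j}) =>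
        if S.1 ⊆ T.1 then (1 : K) else 0))) ⊓
        (⨅ (B : {S : Finset α // S.card = j}) (_ : ¬ B.1 ⊆ V),
          LinearMap.ker (LinearMap.proj (R := K) (φ := fun _ : {S : Finset α // S.card = j} => K) B)))
              ≤ LinearMap.ker (Matrix.mulVecLin (Matrix.of fun (S : {S : Finset α // S.card = k}) (T : {S : Finset α // S.card = j}) =>
        if S.1 ⊆ T.1 then (1 : K) else 0)) :=
  fun z hz => LinearMap.mem_ker.mpr (((mem_shadowKer K j V z).mp hz).1 k hk)
/-- `⨆_{q ∈ V} S_j(V.erase q) ≤ ker W_{k,j}` for `k < j`. -/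
theorem iSup_shadowKer_le_ker (j : ℕ) (V : Finset α) (k : ℕ) (hk : k < j) :
    (⨆ q ∈ V, ((⨅ (k : ℕ) (_ : k < j),
          LinearMap.ker (Matrix.mulVecLin (Matrix.of fun (S : {S : Finset α // S.card = k}) (T : {S : Finset α // S.card = j}) =>
        if S.1 ⊆ T.1 then (1 : K) else 0))) ⊓
        (⨅ (B : {S : Finset α // S.card = j}) (_ : ¬ B.1 ⊆ (V.erase q)),
          LinearMap.ker (LinearMap.proj (R := K) (φ := fun _ : {S : Finset α // S.card = j} => K) B))))
              ≤ LinearMap.ker (Matrix.mulVecLin (Matrix.of fun (S : {S : Finset α // S.card = k}) (T : {S : Finset α // S.card = j}) =>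
        if S.1 ⊆ T.1 then (1 : K) else 0)) :=
  iSup₂_le (fun q _ => shadowKer_le_ker K j (V.erase q) k hk)

omit [Fintype α] [DecidableEq α] in
/-- Induction principle for `⨆ q ∈ s, p q`. -/
theorem biSup_induction {M : Type*} [AddCommGroup M] [Module K M] (s : Finset α) (p : α → Submodule K M)
    (P : M → Prop) (h0 : P 0) (hadd : ∀ x y : M, P x → P y → P (x + y))
    (hmem : ∀ q : α, q ∈ s → ∀ x : M, x ∈ p q → P x) (x : M) (hx : x ∈ ⨆ q ∈ s, p q) : P x := by
  refine Submodule.iSup_induction (fun q => ⨆ (_ : q ∈ s), p q) (motive := P) hx ?_ h0 hadd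
  intro q y hy
  by_cases hq : q ∈ s
  · rw [iSup_pos hq] at hy
    exact hmem q hq y hy
  · rw [iSup_neg hq, Submodule.mem_bot] at hy
    rw [hy]
    exact h0

/-- `del_a` maps `S_{j+1}(V)` into `S_j(V ∖ a)`. -/
theorem del_mem (a : α) (j : ℕ) (V : Finset α) (z : {S : Finset α // S.card = j + 1} → K) (hz : z ∈ ((⨅ (k : ℕ) (_ : k < (j + 1)),
          LinearMap.ker (Matrix.mulVecLin (Matrix.of fun (S : {S : Finset α // S.card = k}) (T : {S : Finset α // S.card = (j + 1)}) =>
        if S.1 ⊆ T.1 then (1 : K) else 0))) ⊓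
        (⨅ (B : {S : Finset α // S.card = (j + 1)}) (_ : ¬ B.1 ⊆ V),
          LinearMap.ker (LinearMap.proj (R := K) (φ := fun _ : {S : Finset α // S.card = (j + 1)} => K) B)))) :
    Matrix.mulVecLin (Matrix.of fun (B' : {S : Finset α // S.card = j}) (B : {S : Finset α // S.card = j + 1}) =>
        if B.1 = insert a B'.1 then (1 : K) else 0) z ∈ ((⨅ (k : ℕ) (_ : k < j),
          LinearMap.ker (Matrix.mulVecLin (Matrix.of fun (S : {S : Finset α // S.card = k}) (T : {S : Finset α // S.card = j}) =>
        if S.1 ⊆ T.1 then (1 : K) else 0))) ⊓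
        (⨅ (B : {S : Finset α // S.card = j}) (_ : ¬ B.1 ⊆ (V.erase a)),
          LinearMap.ker (LinearMap.proj (R := K) (φ := fun _ : {S : Finset α // S.card = j} => K) B))) := by
  rw [mem_shadowKer] at hz ⊢
  exact ⟨fun k hk => incl_del_eq_zero K a k j z (hz.1 (k + 1) (by omega)),
    fun B' hB' => supp_del K a j V z hz.2 B' hB'⟩

/-- `Δ_{a,q} = ins_a − ins_q` maps `S_j(V'')` into `S_{j+1}(V'' ∪ {a, q})` when `a, q ∉ V''`. -/
theorem delta_mem (a q : α) (j : ℕ) (V'' : Finset α) (ha : a ∉ V'') (hq : q ∉ V'') (u : {S : Finset α // S.card = j} → K)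
    (hu : u ∈ ((⨅ (k : ℕ) (_ : k < j),
          LinearMap.ker (Matrix.mulVecLin (Matrix.of fun (S : {S : Finset α // S.card = k}) (T : {S : Finset α // S.card = j}) =>
        if S.1 ⊆ T.1 then (1 : K) else 0))) ⊓
        (⨅ (B : {S : Finset α // S.card = j}) (_ : ¬ B.1 ⊆ V''),
          LinearMap.ker (LinearMap.proj (R := K) (φ := fun _ : {S : Finset α // S.card = j} => K) B)))) :
    Matrix.mulVecLin (Matrix.of fun (B : {S : Finset α // S.card = j + 1}) (B' : {S : Finset α // S.card = j}) =>
        if B.1 = insert a B'.1 then (1 : K) else 0) u - Matrix.mulVecLin (Matrix.of fun (B : {S : Finset α // S.card = j + 1}) (B' : {S : Finset α // S.card = j}) =>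
        if B.1 = insert q B'.1 then (1 : K) else 0) u ∈
      ((⨅ (k : ℕ) (_ : k < (j + 1)),
          LinearMap.ker (Matrix.mulVecLin (Matrix.of fun (S : {S : Finset α // S.card = k}) (T : {S : Finset α // S.card = (j + 1)}) =>
        if S.1 ⊆ T.1 then (1 : K) else 0))) ⊓
        (⨅ (B : {S : Finset α // S.card = (j + 1)}) (_ : ¬ B.1 ⊆ (insert a (insert q V''))),
          LinearMap.ker (LinearMap.proj (R := K) (φ := fun _ : {S : Finset α // S.card = (j + 1)} => K) B))) := by
  rw [mem_shadowKer] at hu ⊢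
  have ha' : ∀ T : {S : Finset α // S.card = j}, a ∈ T.1 → u T = 0 := fun T hT => hu.2 T (fun h => ha (h hT))
  have hq' : ∀ T : {S : Finset α // S.card = j}, q ∈ T.1 → u T = 0 := fun T hT => hu.2 T (fun h => hq (h hT))
  refine ⟨fun k hk => incl_delta_eq_zero K a q j j u ha' hq' hu.1 k hk, fun B hB => ?_⟩
  have t1 := supp_ins K a j (insert q V'') u
    (fun B' hB' => hu.2 B' (fun h => hB' (h.trans (Finset.subset_insert q V'')))) B hB
  have t2 := supp_ins K q j (insert a V'') u
    (fun B' hB' => hu.2 B' (fun h => hB' (h.trans (Finset.subset_insert a V'')))) B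
    (by rwa [Finset.insert_comm] at hB)
  rw [Pi.sub_apply, t1, t2, sub_self]

end Summit.HodgeConjecture.HodgeConjecture.HodgeLocus.Census.InclusionRankShadows
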